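import Literature.Computability.Cryptography.ShorClassicalOracle
import Literature.Computability.Complexity.OracleReplay
import HarnessLib

/-!
# The step function of Shor's classical oracle computation, as a round-by-round replay

Family `PQC`; companion of `ShorClassicalOracle.lean` (`Shor1997.shorComp`, the classical part
of Shor's algorithm as an oracle computation relative to the order-bit oracle) on the way to the
programming fact `Shor1997.shorComp_isPolyTime` (its G01 step function
`(toOracleAlg shorComp).step w answers = toStep (shorComp w) answers` is polynomial-time).
A machine for this step function replays the computation from the start against the recorded
answers (`OracleReplay.lean`): this file gives that replay **as plain recursive functions** —
the specification the stack program is verified against — and proves it equal to the step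
function:

* `orderR x m B as` / `replay_orderQ` — the order query block: with `≥ B` answers left it
  returns `ofAnswerBits` of the first `B` and keeps the rest, otherwise the pending query is
  `((x, m), |as|)`;
* `splitStepR`, `wstepR`, `wrunR` — one splitting attempt, one round, `t` rounds of the
  work-list machine threaded with the answer list (`replay_splitStepM`, `replay_wstepM`,
  `replay_wrunM`), and `wrunR_of_inl` (a stuck round stays stuck);
* `shorStep w as` and **`step_shorComp`**:
  `(toOracleAlg shorComp).step w as = shorStep w as`.

## References

* P. W. Shor, SIAM J. Comput. 26 (1997) 1484–1509, §5 pp.15–16 (the classical reduction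
  around the order-finding subroutine).
* S. Arora, B. Barak, *Computational Complexity*, CUP 2009, §3.4 Def. 3.4 (oracle machines:
  configurations are determined by the input and the answers so far).
-/

namespace Literature.Computability.Cryptography

namespace Shor1997

open _root_.Computability Complexity Complexity.OracleComp

variable {γ : Type}

/-! ### The order query block -/

/-- Replay of the order query against the answers `as`: result and leftover answers, or the
pending query. [cite: Shor1997SICOMP, §5 p.15 (order finding as the subroutine)] -/
def orderR (x m B : ℕ) (as : List (List Bool)) : List Bool ⊕ (ℕ × List (List Bool)) :=
  if B ≤ as.length then Sum.inr (ofAnswerBits (as.take B), as.drop B)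
  else Sum.inl (orderQueryEncoding.encode ((x, m), as.length))

/-- **Replay of the order query.** [folklore] -/
theorem replay_orderQ (x m B : ℕ) (as : List (List Bool)) : replay (orderQ x m B) as = orderR x m B as := by
  unfold orderQ orderR
  rw [replay_bind, replay_forEach_ask]
  by_cases h : B ≤ as.length
  · rw [dif_pos (by simpa using h), if_pos h]; simp
  · rw [dif_neg (by simpa using h), if_neg h]
    simp [List.getElem_range]

/-! ### One splitting attempt -/

/-- Replay of one splitting attempt `splitStepM m X` against the answers: the branches without
a query pass the answers through; the order branch consumes `size m` answers or is stuck.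
[cite: Shor1997SICOMP, §5 p.16 (reduction of factoring to order finding)] -/
def splitStepR (m X : ℕ) (as : List (List Bool)) : List Bool ⊕ (Option ℕ × List (List Bool)) :=
  if Even m then Sum.inr ((if m = 2 then none else some 2), as)
  else if ppBase m < m then Sum.inr (some (ppBase m), as)
  else
    let x := X % 2 ^ Nat.size m
    if x = 0 ∨ m ≤ x then Sum.inr (none, as)
    else if 1 < Nat.gcd x m then Sum.inr (some (Nat.gcd x m), as)
    else match orderR x m m.size as with
      | Sum.inl q => Sum.inl q
      | Sum.inr (r, as') =>
        Sum.inr ((if Even r ∧ ¬ m ∣ x ^ (r / 2) + 1 then some (Nat.gcd (x ^ (r / 2) - 1) m) else none), as')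

/-- **Replay of one splitting attempt.** [folklore] -/
theorem replay_splitStepM (m X : ℕ) (as : List (List Bool)) : replay (splitStepM m X) as = splitStepR m X as := by
  unfold splitStepM splitStepR
  by_cases he : Even m
  · rw [if_pos he, if_pos he, replay_pure]
  rw [if_neg he, if_neg he]
  by_cases hpp : ppBase m < m
  · rw [if_pos hpp, if_pos hpp, replay_pure]
  rw [if_neg hpp, if_neg hpp]
  dsimp only
  by_cases h0 : X % 2 ^ m.size = 0 ∨ m ≤ X % 2 ^ m.size
  · rw [if_pos h0, if_pos h0, replay_pure]
  rw [if_neg h0, if_neg h0]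
  by_cases hg : 1 < Nat.gcd (X % 2 ^ m.size) m
  · rw [if_pos hg, if_pos hg, replay_pure]
  rw [if_neg hg, if_neg hg, replay_bind, replay_orderQ]
  rcases orderR (X % 2 ^ m.size) m m.size as with q | ⟨r, as'⟩
  · rfl
  · simp

/-! ### Rounds of the work-list machine -/

/-- Replay of one round `wstepM T s X`. [folklore] -/
def wstepR (T : ℕ) (s : WState) (X : ℕ) (as : List (List Bool)) : List Bool ⊕ (WState × List (List Bool)) :=
  match s.todo with
  | [] => Sum.inr (s, as)
  | (m, k) :: rest =>
    match splitStepR m X as with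
    | Sum.inl q => Sum.inl q
    | Sum.inr (o, as') =>
      Sum.inr ((match o with
        | some d => ⟨s.done, (d, T) :: (m / d, T) :: rest⟩
        | none => if k ≤ 1 then ⟨m :: s.done, rest⟩ else ⟨s.done, (m, k - 1) :: rest⟩), as')

/-- **Replay of one round.** [folklore] -/
theorem replay_wstepM (T : ℕ) (s : WState) (X : ℕ) (as : List (List Bool)) :
    replay (wstepM T s X) as = wstepR T s X as := by
  unfold wstepM wstepR
  rcases hs : s.todo with _ | ⟨⟨m, k⟩, rest⟩
  · simp
  · simp only
    rw [replay_bind, replay_splitStepM]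
    rcases splitStepR m X as with q | ⟨o, as'⟩
    · rfl
    · cases o <;> simp

/-- Replay of `t` rounds `wrunM T X s₀ t`: round `i` consumes the block value `X i` and its
share of the answers; a stuck round stops the replay. [folklore] -/
def wrunR (T : ℕ) (X : ℕ → ℕ) (s₀ : WState) : ℕ → List (List Bool) → List Bool ⊕ (WState × List (List Bool))
  | 0, as => Sum.inr (s₀, as)
  | t + 1, as =>
    match wrunR T X s₀ t as with
    | Sum.inl q => Sum.inl q
    | Sum.inr (s, as') => wstepR T s (X t) as'

/-- **Replay of the rounds.** [folklore] -/
theorem replay_wrunM (T : ℕ) (X : ℕ → ℕ) (s₀ : WState) : ∀ (t : ℕ) (as : List (List Bool)),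
    replay (wrunM T X s₀ t) as = wrunR T X s₀ t as
  | 0, as => by simp [wrunM, wrunR]
  | t + 1, as => by
    simp only [wrunM, wrunR]
    rw [replay_bind, replay_wrunM T X s₀ t as]
    rcases wrunR T X s₀ t as with q | ⟨s, as'⟩
    · rfl
    · simp [replay_wstepM]

/-- A stuck replay stays stuck in later rounds. [folklore] -/
theorem wrunR_of_inl {T : ℕ} {X : ℕ → ℕ} {s₀ : WState} {t : ℕ} {as : List (List Bool)} {q : List Bool}
    (h : wrunR T X s₀ t as = Sum.inl q) : ∀ t', t ≤ t' → wrunR T X s₀ t' as = Sum.inl q := by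
  intro t' ht
  induction ht with
  | refl => exact h
  | step _ ih => simp [wrunR, ih]

/-- One more round from a finished replay. [folklore] -/
theorem wrunR_succ_of_inr {T : ℕ} {X : ℕ → ℕ} {s₀ s : WState} {t : ℕ} {as as' : List (List Bool)}
    (h : wrunR T X s₀ t as = Sum.inr (s, as')) : wrunR T X s₀ (t + 1) as = wstepR T s (X t) as' := by
  simp [wrunR, h]

/-! ### The whole step function -/

/-- **The step function of `shorComp`, by replay**: parse `w = ⟨x, c⟩`, `n = decodeNat x`; for
`n ≤ 1` output the empty list at once; otherwise replay the `rounds |x|` rounds against the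
answers and either report the pending order query or output the encoded sorted list of the
numbers declared prime. [cite: Shor1997SICOMP, §5 pp.15–16 (the classical reduction around order finding)] -/
def shorStep (w : List Bool) (as : List (List Bool)) : List Bool ⊕ List Bool :=
  let x := (boolUnpair w).1
  let c := (boolUnpair w).2
  if decodeNat x ≤ 1 then Sum.inr (encodingListNatBool.encode ([] : List ℕ))
  else
    match wrunR (budget x.length) (Xof (coinBlocks (rounds x.length) (blockLen x.length) c))
        (winit (decodeNat x) (budget x.length)) (rounds x.length) as with
    | Sum.inl q => Sum.inl q
    | Sum.inr (s, _) => Sum.inr (encodingListNatBool.encode (s.done.insertionSort (· ≤ ·)))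

/-- Replay of the driver. [folklore] -/
theorem replay_shorDriverM (n T R : ℕ) (X : ℕ → ℕ) (as : List (List Bool)) :
    replay (shorDriverM n T R X) as =
      if n ≤ 1 then Sum.inr ([], as)
      else match wrunR T X (winit n T) R as with
        | Sum.inl q => Sum.inl q
        | Sum.inr (s, as') => Sum.inr (s.done.insertionSort (· ≤ ·), as') := by
  unfold shorDriverM
  split_ifs with h
  · simp
  · rw [replay_bind, replay_wrunM]
    rcases wrunR T X (winit n T) R as with q | ⟨s, as'⟩
    · rfl
    · simp

/-- **The step function of `shorComp` is `shorStep`.** [cite: Shor1997SICOMP, §5 pp.15–16 (the classical reduction around order finding)] -/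
theorem toStep_shorComp (w : List Bool) (as : List (List Bool)) : toStep (shorComp w) as = shorStep w as := by
  unfold shorComp shorCompPair shorStep
  rw [toStep_eq_replay, replay_bind, replay_shorDriverM]
  dsimp only
  split_ifs with h
  · simp
  · rcases wrunR (budget (boolUnpair w).1.length)
        (Xof (coinBlocks (rounds (boolUnpair w).1.length) (blockLen (boolUnpair w).1.length) (boolUnpair w).2))
        (winit (decodeNat (boolUnpair w).1) (budget (boolUnpair w).1.length)) (rounds (boolUnpair w).1.length) as
      with q | ⟨s, as'⟩
    · rfl
    · simp

/-- The G01 step function of `toOracleAlg shorComp` is `shorStep`. [folklore] -/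
theorem step_shorComp (w : List Bool) (as : List (List Bool)) :
    (toOracleAlg shorComp).step w as = shorStep w as :=
  toStep_shorComp w as

end Shor1997

end Literature.Computability.Cryptography
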